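import Summits.QuantumFields.YangMills.Theorems.BalabanUVNodesN15CurvedGluingCubeSpeciesBoundary
import HarnessLib

/-!
# Route «BalabanUVNodes» (cluster K4 «SpineRates»), Track-A DAG node N15 = NE2, BACKGROUND LAYER — THE SPECIES OF A DIRICHLET CUBE, IV: the cube propagator's ENTRIES 0∕1 from ANY majorant of the
# dressed pair, and BY NAME for `cubeInv (Δ_U + W) χ` at a LIVE background under the print-compatible smallness `(βR_b + β_∂R_∂)c_r < 1` (dag-n15-c FILE 55's per-cube rows `hG`, `hD`, `hDb`)

Cell `pub-ymgap`, seat `pub-ymgap-dag-n15-w3` (WIDTH SEAT 3∕3 on node N15, director-ym №197 ∕ HUMAN RULING D-0149; plan `W-SEAT-START-LIST.md` §n15 item 3 — nineteenth piece, the companion of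
file 18 split off for the 400-line rule).  `bears_on: R4∕N15 · K3⁷ SpineGivenEndpointR13SepCoPH (stmt-QuantumFields-20544)`.  Filed `--kind proof --supports stmt-QuantumFields-20544 --as helper` —
COUNT-NEUTRAL.  Theorems only; 0 `sorry`.  Imports BY NAME file 18 `…N15CurvedGluingCubeSpeciesBoundary` (`hasMaj_bgPairM_cmpr_bdry`; files 16–17 `cubeInv_sub_speciesOpM_eq`,
`fgrad_comp_cubeInv_sub_speciesOpM_eq`, `bgrad_comp_cubeInv_sub_speciesOpM_eq`, `hasMaj_sandwich_localize`, `covLapM_add_eq_lapOp_sub`; M1 `bgPairM`∕`hasMaj_projO_comp`); nothing in the tree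
is modified.

WHY.  File 18 produced the dressed cube pair's majorant `X̂ ≤ β(1 − qc_r)⁻¹e^{−ρd}` under the print-compatible smallness `q = βR_b + β_∂R_∂` (bulk letters + the flat cube resolvent's BOUNDARY
letter).  THIS FILE reads the cube propagator's localized entries off ANY pair majorant `X̂ ≤ A₀e^{−ρd}` (so files 16–17's crude edition and file 18's edition are both instances) and states
them BY NAME for dag-n15-c's `cubeInv (covLapM τ η U + W) χ` at a LIVE background `U` — the per-cube rows `hG`, `hD`, `hDb` of FILE 55's bundle, one grid, with every letter displayed and the
smallness in (3.35)'s regime (`β_∂c_χ = O(β)`).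

* §1 ★ `hasMaj_cubeInv_of_pair`, ★ `hasMaj_fgrad_comp_cubeInv_of_pair`, ★ `hasMaj_bgrad_comp_cubeInv_of_pair` (entries 0∕1 of `cubeInv (Δ − V(c,a)) χ` from a pair majorant `A₀e^{−ρd}`:
  `1_S1_S·A₀e^{−ρd}`, `1_S1_S·(1 + c_χ)A₀e^{−ρd}`);
* §2 ★★★ `hasMaj_cubeInv_covLapM_add_bdry`, ★★ `hasMaj_fgrad_comp_cubeInv_covLapM_add_bdry`, ★★ `hasMaj_bgrad_comp_cubeInv_covLapM_add_bdry`.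

HONEST FRAMING ∕ LIMITS.  As file 18: bookkeeping over DISPLAYED letters (flat cube resolvent bulk `β` and boundary `β_∂` entries — the thin-layer gain `β_∂ = O(ηβ)` is NOT proved here —,
transport rows, cut-off letters, the unit of `dirOp`); ONE grid; right entries not here; nothing of [B6]∕[B9] asserted ((2.133) p. 247, (3.50)–(3.53) p. 400, (3.62)–(3.65) pp. 402–403, p. 399 =
SHAPES ∕ MECHANISM).  NE2⁺ NOT PRINTED, NOT proved; N15 NOT discharged; counts of record UNMOVED (typed 28∕28 · discharged 5∕27); one finite 𝕋⁴ at fixed ε — NOT infinite volume, NOT OS on ℝ⁴,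
NOT a mass gap, NOT Clay; R4 closes the conditional finite-𝕋⁴ rung `BalabanLadder.UV` only.  Restate-immune (no Theses import).
-/

set_option autoImplicit false

noncomputable section
open scoped BigOperators
open Finset

namespace Summit.QuantumFields.YangMills.BalabanUVNodes.N15.CurvedSpecies

open Literature.MathematicalPhysics.QuantumFieldTheory.Balaban1983to89
open Literature.MathematicalPhysics.QuantumFieldTheory.Balaban1983to89.B11SectG (BlockNorm HasMaj RowSum)
open Literature.MathematicalPhysics.QuantumFieldTheory.Balaban1983to89.T4EtaRateCoeffDefect (diagK diagK_nonneg hasMaj_mulOp)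
open Literature.MathematicalPhysics.QuantumFieldTheory.Balaban1983to89.B6RandomWalk (Triangle254)
open Literature.MathematicalPhysics.QuantumFieldTheory.Balaban1983to89.B6Prop26Gluing (mulOp mulOp_apply ind ind_nonneg)
open Summit.QuantumFields.YangMills.BalabanUVNodes.N15.MatrixSpecies (mmulOp liftBlk liftEquiv liftEquiv_apply liftEquiv_symm_apply)
open Summit.QuantumFields.YangMills.BalabanUVNodes.N15.BackgroundLayer (fgrad bgrad fgrad_apply bgrad_apply speciesOpM stack projO blkPair hasMaj_projO_comp unstackM bgPairM covLapM tCoefA tCoefC)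
open Summit.QuantumFields.YangMills.BalabanUVNodes.N15.Gluing (dirOp cubeInv lapOp hasMaj_localize sandwich_in_out hasMaj_diag_comp hasMaj_comp_diag)

/-! ## §1 From a pair majorant to the cube propagator's localized entries -/

section OfPair

variable {X ι J : Type} [Fintype X] [DecidableEq X] [Fintype ι] [DecidableEq ι] [Fintype J] [DecidableEq J] {g : B6.Geometry} (blk : X → g.Site)
  (τ : J → X ≃ X) (n : ℝ) (χX : X → ℝ) (C : X → Matrix ι ι ℝ) (A : J ⊕ J → X → Matrix ι ι ℝ) (Δ : (X × ι → ℝ) →ₗ[ℝ] (X × ι → ℝ))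

/-- ★ ENTRY 0 FROM A PAIR MAJORANT: `X̂ ≤ A₀e^{−ρd}` (`A₀ ≥ 0`), the Neumann unit, `dirOp Δ χ` a unit, `χ² = χ`, `|χ| ≤ 1`, `supp χ` over `S` ⟹ `cubeInv (Δ − V(c,a)) χ ≤ 1_S1_S·A₀·e^{−ρd}`.
[cite: Balaban1984PropagatorsII, (2.133) p.247 (shape); Balaban1985BackgroundPropagators, (3.64) p.403 (mechanism)] -/
theorem hasMaj_cubeInv_of_pair {S : Set g.Site} {A₀ ρ : ℝ} (hA₀ : 0 ≤ A₀) (hχ2 : χX * χX = χX) (hχ : ∀ x, |χX x| ≤ 1) (hS : ∀ x, χX x ≠ 0 → blk x ∈ S)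
    (hunit₀ : IsUnit (LinearMap.toMatrix' (dirOp Δ (fun p : X × ι => χX p.1))))
    (hunit : IsUnit (1 - LinearMap.toMatrix' (stack (cubeRes Δ (fun p : X × ι => χX p.1))
      (Sum.elim (fun μ => fgrad n (liftEquiv (τ μ) ι) ∘ₗ cubeRes Δ (fun p : X × ι => χX p.1)) (fun μ => bgrad n (liftEquiv (τ μ) ι) ∘ₗ cubeRes Δ (fun p : X × ι => χX p.1))) ∘ₗ
      unstackM (cmprC τ n χX C A) (cmprA τ χX A))))
    (hX : HasMaj (BlockNorm.ofBlocks g (liftBlk blk ι)) (BlockNorm.ofBlocks g (blkPair (liftBlk blk ι)))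
      (bgPairM (cubeRes Δ (fun p : X × ι => χX p.1))
        (Sum.elim (fun μ => fgrad n (liftEquiv (τ μ) ι) ∘ₗ cubeRes Δ (fun p : X × ι => χX p.1)) (fun μ => bgrad n (liftEquiv (τ μ) ι) ∘ₗ cubeRes Δ (fun p : X × ι => χX p.1)))
        (cmprC τ n χX C A) (cmprA τ χX A)) (fun y y' => A₀ * Real.exp (-(ρ * g.dist y y')))) :
    HasMaj (BlockNorm.ofBlocks g (liftBlk blk ι)) (BlockNorm.ofBlocks g (liftBlk blk ι)) (cubeInv (Δ - speciesOpM τ n C A) (fun p : X × ι => χX p.1))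
      (fun y y' => ind S y * ind S y' * (A₀ * Real.exp (-(ρ * g.dist y y')))) := by
  have hK : ∀ a b : g.Site, 0 ≤ A₀ * Real.exp (-(ρ * g.dist a b)) := fun a b => mul_nonneg hA₀ (Real.exp_nonneg _)
  have hχ2p : (fun p : X × ι => χX p.1) * (fun p : X × ι => χX p.1) = fun p : X × ι => χX p.1 := funext fun p => by
    have := congrArg (fun f => f p.1) hχ2
    simpa only [Pi.mul_apply] using this
  have hχp : ∀ p : X × ι, |(fun p : X × ι => χX p.1) p| ≤ 1 := fun p => hχ p.1
  have hSp : ∀ p : X × ι, (fun p : X × ι => χX p.1) p ≠ 0 → blk p.1 ∈ S := fun p hp => hS p.1 hp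
  have hT := hasMaj_sandwich_localize blk (ψ := fun p : X × ι => χX p.1) hK zero_le_one hχp hχp hSp hSp (hasMaj_projO_comp (liftBlk blk ι) hX none)
  rw [cubeInv_sub_speciesOpM_eq τ n C A χX Δ hunit₀ rfl (fun _ => rfl) (fun _ => rfl) hunit]
  refine hT.mono fun y y' => le_of_eq ?_
  ring

/-- ★ ENTRY 1 (forward) FROM A PAIR MAJORANT: `∇⁺_μ∘cubeInv (Δ − V(c,a)) χ ≤ 1_S1_S·(1 + c_χ)A₀·e^{−ρd}` (`|∇⁺_μχ| ≤ c_χ`, `supp χ∘τ_μ` over `S`). [cite: Balaban1984PropagatorsII, (2.133) p.247 (shape)] -/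
theorem hasMaj_fgrad_comp_cubeInv_of_pair {S : Set g.Site} {A₀ ρ cχ : ℝ} (hA₀ : 0 ≤ A₀) (hcχ : 0 ≤ cχ) (hχ : ∀ x, |χX x| ≤ 1) (μ : J) (hdχ : ∀ x, |fgrad n (τ μ) χX x| ≤ cχ)
    (hS : ∀ x, χX x ≠ 0 → blk x ∈ S) (hSτ : ∀ x, χX (τ μ x) ≠ 0 → blk x ∈ S) (hunit₀ : IsUnit (LinearMap.toMatrix' (dirOp Δ (fun p : X × ι => χX p.1))))
    (hunit : IsUnit (1 - LinearMap.toMatrix' (stack (cubeRes Δ (fun p : X × ι => χX p.1))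
      (Sum.elim (fun μ => fgrad n (liftEquiv (τ μ) ι) ∘ₗ cubeRes Δ (fun p : X × ι => χX p.1)) (fun μ => bgrad n (liftEquiv (τ μ) ι) ∘ₗ cubeRes Δ (fun p : X × ι => χX p.1))) ∘ₗ
      unstackM (cmprC τ n χX C A) (cmprA τ χX A))))
    (hX : HasMaj (BlockNorm.ofBlocks g (liftBlk blk ι)) (BlockNorm.ofBlocks g (blkPair (liftBlk blk ι)))
      (bgPairM (cubeRes Δ (fun p : X × ι => χX p.1))
        (Sum.elim (fun μ => fgrad n (liftEquiv (τ μ) ι) ∘ₗ cubeRes Δ (fun p : X × ι => χX p.1)) (fun μ => bgrad n (liftEquiv (τ μ) ι) ∘ₗ cubeRes Δ (fun p : X × ι => χX p.1)))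
        (cmprC τ n χX C A) (cmprA τ χX A)) (fun y y' => A₀ * Real.exp (-(ρ * g.dist y y')))) :
    HasMaj (BlockNorm.ofBlocks g (liftBlk blk ι)) (BlockNorm.ofBlocks g (liftBlk blk ι)) (fgrad n (liftEquiv (τ μ) ι) ∘ₗ cubeInv (Δ - speciesOpM τ n C A) (fun p : X × ι => χX p.1))
      (fun y y' => ind S y * ind S y' * ((1 + cχ) * A₀ * Real.exp (-(ρ * g.dist y y')))) := by
  have hK : ∀ a b : g.Site, 0 ≤ A₀ * Real.exp (-(ρ * g.dist a b)) := fun a b => mul_nonneg hA₀ (Real.exp_nonneg _)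
  have hχp : ∀ p : X × ι, |(fun p : X × ι => χX p.1) p| ≤ 1 := fun p => hχ p.1
  have hSp : ∀ p : X × ι, (fun p : X × ι => χX p.1) p ≠ 0 → blk p.1 ∈ S := fun p hp => hS p.1 hp
  have t1 := hasMaj_sandwich_localize blk (ψ := (fun p : X × ι => χX p.1) ∘ ⇑(liftEquiv (τ μ) ι)) hK zero_le_one
    (fun p => by simpa only [Function.comp_apply, liftEquiv_apply] using hχ (τ μ p.1)) hχp
    (fun p hp => hSτ p.1 (by simpa only [Function.comp_apply, liftEquiv_apply] using hp)) hSp (hasMaj_projO_comp (liftBlk blk ι) hX (some (Sum.inl μ)))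
  have t2 := hasMaj_sandwich_localize blk (ψ := fgrad n (liftEquiv (τ μ) ι) (fun p : X × ι => χX p.1)) hK hcχ
    (fun p => by simpa only [fgrad_apply, liftEquiv_apply] using hdχ p.1) hχp
    (fun p hp => by
      by_contra hnot
      have h1 : χX (τ μ p.1) = 0 := by by_contra h; exact hnot (hSτ p.1 h)
      have h2 : χX p.1 = 0 := by by_contra h; exact hnot (hS p.1 h)
      exact hp (by simp only [fgrad_apply, liftEquiv_apply, h1, h2, sub_self, mul_zero]))
    hSp (hasMaj_projO_comp (liftBlk blk ι) hX none)
  rw [fgrad_comp_cubeInv_sub_speciesOpM_eq τ n χX C A Δ hunit₀ hunit μ]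
  refine (t1.add t2).mono fun y y' => le_of_eq ?_
  ring

/-- ★ ENTRY 1 (backward) FROM A PAIR MAJORANT: `∇⁻_μ∘cubeInv (Δ − V(c,a)) χ ≤ 1_S1_S·(1 + c_χ)A₀·e^{−ρd}` (`|∇⁻_μχ| ≤ c_χ`, `supp χ∘τ_μ⁻¹` over `S`). [cite: Balaban1984PropagatorsII, (2.133) p.247 (shape)] -/
theorem hasMaj_bgrad_comp_cubeInv_of_pair {S : Set g.Site} {A₀ ρ cχ : ℝ} (hA₀ : 0 ≤ A₀) (hcχ : 0 ≤ cχ) (hχ : ∀ x, |χX x| ≤ 1) (μ : J) (hdχb : ∀ x, |bgrad n (τ μ) χX x| ≤ cχ)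
    (hS : ∀ x, χX x ≠ 0 → blk x ∈ S) (hSτ : ∀ x, χX ((τ μ).symm x) ≠ 0 → blk x ∈ S) (hunit₀ : IsUnit (LinearMap.toMatrix' (dirOp Δ (fun p : X × ι => χX p.1))))
    (hunit : IsUnit (1 - LinearMap.toMatrix' (stack (cubeRes Δ (fun p : X × ι => χX p.1))
      (Sum.elim (fun μ => fgrad n (liftEquiv (τ μ) ι) ∘ₗ cubeRes Δ (fun p : X × ι => χX p.1)) (fun μ => bgrad n (liftEquiv (τ μ) ι) ∘ₗ cubeRes Δ (fun p : X × ι => χX p.1))) ∘ₗ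
      unstackM (cmprC τ n χX C A) (cmprA τ χX A))))
    (hX : HasMaj (BlockNorm.ofBlocks g (liftBlk blk ι)) (BlockNorm.ofBlocks g (blkPair (liftBlk blk ι)))
      (bgPairM (cubeRes Δ (fun p : X × ι => χX p.1))
        (Sum.elim (fun μ => fgrad n (liftEquiv (τ μ) ι) ∘ₗ cubeRes Δ (fun p : X × ι => χX p.1)) (fun μ => bgrad n (liftEquiv (τ μ) ι) ∘ₗ cubeRes Δ (fun p : X × ι => χX p.1)))
        (cmprC τ n χX C A) (cmprA τ χX A)) (fun y y' => A₀ * Real.exp (-(ρ * g.dist y y')))) :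
    HasMaj (BlockNorm.ofBlocks g (liftBlk blk ι)) (BlockNorm.ofBlocks g (liftBlk blk ι)) (bgrad n (liftEquiv (τ μ) ι) ∘ₗ cubeInv (Δ - speciesOpM τ n C A) (fun p : X × ι => χX p.1))
      (fun y y' => ind S y * ind S y' * ((1 + cχ) * A₀ * Real.exp (-(ρ * g.dist y y')))) := by
  have hK : ∀ a b : g.Site, 0 ≤ A₀ * Real.exp (-(ρ * g.dist a b)) := fun a b => mul_nonneg hA₀ (Real.exp_nonneg _)
  have hχp : ∀ p : X × ι, |(fun p : X × ι => χX p.1) p| ≤ 1 := fun p => hχ p.1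
  have hSp : ∀ p : X × ι, (fun p : X × ι => χX p.1) p ≠ 0 → blk p.1 ∈ S := fun p hp => hS p.1 hp
  have t1 := hasMaj_sandwich_localize blk (ψ := (fun p : X × ι => χX p.1) ∘ ⇑(liftEquiv (τ μ) ι).symm) hK zero_le_one
    (fun p => by simpa only [Function.comp_apply, liftEquiv_symm_apply] using hχ ((τ μ).symm p.1)) hχp
    (fun p hp => hSτ p.1 (by simpa only [Function.comp_apply, liftEquiv_symm_apply] using hp)) hSp (hasMaj_projO_comp (liftBlk blk ι) hX (some (Sum.inr μ)))
  have t2 := hasMaj_sandwich_localize blk (ψ := bgrad n (liftEquiv (τ μ) ι) (fun p : X × ι => χX p.1)) hK hcχ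
    (fun p => by simpa only [bgrad_apply, liftEquiv_symm_apply] using hdχb p.1) hχp
    (fun p hp => by
      by_contra hnot
      have h1 : χX ((τ μ).symm p.1) = 0 := by by_contra h; exact hnot (hSτ p.1 h)
      have h2 : χX p.1 = 0 := by by_contra h; exact hnot (hS p.1 h)
      exact hp (by simp only [bgrad_apply, liftEquiv_symm_apply, h1, h2, sub_self, mul_zero]))
    hSp (hasMaj_projO_comp (liftBlk blk ι) hX none)
  rw [bgrad_comp_cubeInv_sub_speciesOpM_eq τ n χX C A Δ hunit₀ hunit μ]
  refine (t1.add t2).mono fun y y' => le_of_eq ?_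
  ring

end OfPair

/-! ## §2 By name at `Δ_U + W` under the print-compatible smallness -/

section CovariantBdry

variable {X ι J : Type} [Fintype X] [DecidableEq X] [Fintype ι] [DecidableEq ι] [Fintype J] [DecidableEq J] {g : B6.Geometry} (blk : X → g.Site)
  (τ : J → X ≃ X) (η : ℝ) (χX ψ : X → ℝ) (U : J ⊕ J → X → Matrix ι ι ℝ) (W : (X × ι → ℝ) →ₗ[ℝ] (X × ι → ℝ)) {σ cr : ℝ}

/-- ★★★ **ENTRY 0 OF `cubeInv (Δ_U + W) χ` AT A LIVE BACKGROUND, PRINT-COMPATIBLE SMALLNESS** (dag-n15-c FILE 55's `hG`, one grid): flat cube resolvent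
`N_□ = cubeRes (lapOp η⁻¹ (liftEquiv∘τ) W) χ` with bulk entries `N_□, ∇^±N_□ ≤ βe^{−δd}` and BOUNDARY entries `N_□∘M_ψ, ∇^±N_□∘M_ψ ≤ β_∂e^{−δd}` (`ψ` carries the cut-off's quotients),
transport rows `r_c, r_a`, `q := βR_b + β_∂R_∂`, `R_b = (r_c + r_a)(1 + |J ⊕ J|)`, `R_∂ = |J|·2c_χr_a·(1 + |J ⊕ J|)`, `qc_r < 1` ⟹ `cubeInv (Δ_U + W) χ ≤ 1_S1_S·β(1 − qc_r)⁻¹·e^{−ρd}`.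
[cite: Balaban1985BackgroundPropagators, p.399 («expanding with respect to A»), (3.50)–(3.53) p.400; Balaban1984PropagatorsII, (2.133) p.247, pp.230–231] -/
theorem hasMaj_cubeInv_covLapM_add_bdry (htri : Triangle254 g) (hd : ∀ a b : g.Site, 0 ≤ g.dist a b) (hrow : RowSum g σ cr) (hσ : 0 ≤ σ) {ρ δ β βd rC rA cχ : ℝ} (hρ : 0 ≤ ρ)
    (hρδ : ρ + σ ≤ δ) (hβ : 0 ≤ β) (hβd : 0 ≤ βd) (hrC : 0 ≤ rC) (hrA : 0 ≤ rA) (hcχ : 0 ≤ cχ) {S : Set g.Site} (hχ2 : χX * χX = χX) (hχ : ∀ x, |χX x| ≤ 1)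
    (hdχ : ∀ μ x, |fgrad η⁻¹ (τ μ) χX x| ≤ cχ) (hdχb : ∀ μ x, |bgrad η⁻¹ (τ μ) χX x| ≤ cχ) (hψ : ∀ μ x, ψ x ≠ 1 → fgrad η⁻¹ (τ μ) χX x = 0 ∧ bgrad η⁻¹ (τ μ) χX x = 0)
    (hS : ∀ x, χX x ≠ 0 → blk x ∈ S) (hC : ∀ x i, ∑ k, |tCoefC η U x i k| ≤ rC) (hA : ∀ j x i, ∑ k, |tCoefA η U j x i k| ≤ rA)
    (hunit₀ : IsUnit (LinearMap.toMatrix' (dirOp (lapOp η⁻¹ (fun μ => liftEquiv (τ μ) ι) W) (fun p : X × ι => χX p.1))))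
    (hN : HasMaj (BlockNorm.ofBlocks g (liftBlk blk ι)) (BlockNorm.ofBlocks g (liftBlk blk ι)) (cubeRes (lapOp η⁻¹ (fun μ => liftEquiv (τ μ) ι) W) (fun p : X × ι => χX p.1))
      (fun y y' => β * Real.exp (-(δ * g.dist y y'))))
    (hDN : ∀ μ, HasMaj (BlockNorm.ofBlocks g (liftBlk blk ι)) (BlockNorm.ofBlocks g (liftBlk blk ι))
      (fgrad η⁻¹ (liftEquiv (τ μ) ι) ∘ₗ cubeRes (lapOp η⁻¹ (fun μ => liftEquiv (τ μ) ι) W) (fun p : X × ι => χX p.1)) (fun y y' => β * Real.exp (-(δ * g.dist y y'))))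
    (hDNb : ∀ μ, HasMaj (BlockNorm.ofBlocks g (liftBlk blk ι)) (BlockNorm.ofBlocks g (liftBlk blk ι))
      (bgrad η⁻¹ (liftEquiv (τ μ) ι) ∘ₗ cubeRes (lapOp η⁻¹ (fun μ => liftEquiv (τ μ) ι) W) (fun p : X × ι => χX p.1)) (fun y y' => β * Real.exp (-(δ * g.dist y y'))))
    (hNd : HasMaj (BlockNorm.ofBlocks g (liftBlk blk ι)) (BlockNorm.ofBlocks g (liftBlk blk ι))
      (cubeRes (lapOp η⁻¹ (fun μ => liftEquiv (τ μ) ι) W) (fun p : X × ι => χX p.1) ∘ₗ mulOp (fun p : X × ι => ψ p.1)) (fun y y' => βd * Real.exp (-(δ * g.dist y y'))))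
    (hDNd : ∀ μ, HasMaj (BlockNorm.ofBlocks g (liftBlk blk ι)) (BlockNorm.ofBlocks g (liftBlk blk ι))
      ((fgrad η⁻¹ (liftEquiv (τ μ) ι) ∘ₗ cubeRes (lapOp η⁻¹ (fun μ => liftEquiv (τ μ) ι) W) (fun p : X × ι => χX p.1)) ∘ₗ mulOp (fun p : X × ι => ψ p.1))
      (fun y y' => βd * Real.exp (-(δ * g.dist y y'))))
    (hDNbd : ∀ μ, HasMaj (BlockNorm.ofBlocks g (liftBlk blk ι)) (BlockNorm.ofBlocks g (liftBlk blk ι))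
      ((bgrad η⁻¹ (liftEquiv (τ μ) ι) ∘ₗ cubeRes (lapOp η⁻¹ (fun μ => liftEquiv (τ μ) ι) W) (fun p : X × ι => χX p.1)) ∘ₗ mulOp (fun p : X × ι => ψ p.1))
      (fun y y' => βd * Real.exp (-(δ * g.dist y y'))))
    (hq : (β * ((rC + rA) * (1 + Fintype.card (J ⊕ J))) + βd * (Fintype.card J * (2 * (cχ * rA)) * (1 + Fintype.card (J ⊕ J)))) * cr < 1) :
    HasMaj (BlockNorm.ofBlocks g (liftBlk blk ι)) (BlockNorm.ofBlocks g (liftBlk blk ι)) (cubeInv (covLapM τ η U + W) (fun p : X × ι => χX p.1))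
      (fun y y' => ind S y * ind S y' *
        (β * (1 - (β * ((rC + rA) * (1 + Fintype.card (J ⊕ J))) + βd * (Fintype.card J * (2 * (cχ * rA)) * (1 + Fintype.card (J ⊕ J)))) * cr)⁻¹ * Real.exp (-(ρ * g.dist y y')))) := by
  obtain ⟨hunit, hX⟩ := hasMaj_bgPairM_cmpr_bdry τ η⁻¹ χX (tCoefC η U) (tCoefA η U) blk (lapOp η⁻¹ (fun μ => liftEquiv (τ μ) ι) W) ψ htri hd hrow hσ hρ hρδ hβ hβd hrC hrA hcχ hχ hdχ hdχb hψ
    hC hA hN hDN hDNb hNd hDNd hDNbd hq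
  rw [covLapM_add_eq_lapOp_sub]
  exact hasMaj_cubeInv_of_pair blk τ η⁻¹ χX (tCoefC η U) (tCoefA η U) _ (mul_nonneg hβ (inv_nonneg.2 (by linarith))) hχ2 hχ hS hunit₀ hunit hX

/-- ★★ **ENTRY 1 (forward) OF `cubeInv (Δ_U + W) χ`, PRINT-COMPATIBLE SMALLNESS** (FILE 55's `hD`): `∇⁺_μ∘cubeInv (Δ_U + W) χ ≤ 1_S1_S·(1 + c_χ)β(1 − qc_r)⁻¹e^{−ρd}`.
[cite: Balaban1984PropagatorsII, (2.133) p.247 (shape); Balaban1985BackgroundPropagators, p.399, (3.50)–(3.53) p.400] -/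
theorem hasMaj_fgrad_comp_cubeInv_covLapM_add_bdry (htri : Triangle254 g) (hd : ∀ a b : g.Site, 0 ≤ g.dist a b) (hrow : RowSum g σ cr) (hσ : 0 ≤ σ) {ρ δ β βd rC rA cχ : ℝ}
    (hρ : 0 ≤ ρ) (hρδ : ρ + σ ≤ δ) (hβ : 0 ≤ β) (hβd : 0 ≤ βd) (hrC : 0 ≤ rC) (hrA : 0 ≤ rA) (hcχ : 0 ≤ cχ) {S : Set g.Site} (hχ : ∀ x, |χX x| ≤ 1)
    (hdχ : ∀ μ x, |fgrad η⁻¹ (τ μ) χX x| ≤ cχ) (hdχb : ∀ μ x, |bgrad η⁻¹ (τ μ) χX x| ≤ cχ) (hψ : ∀ μ x, ψ x ≠ 1 → fgrad η⁻¹ (τ μ) χX x = 0 ∧ bgrad η⁻¹ (τ μ) χX x = 0)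
    (hS : ∀ x, χX x ≠ 0 → blk x ∈ S) (μ : J) (hSτ : ∀ x, χX (τ μ x) ≠ 0 → blk x ∈ S) (hC : ∀ x i, ∑ k, |tCoefC η U x i k| ≤ rC) (hA : ∀ j x i, ∑ k, |tCoefA η U j x i k| ≤ rA)
    (hunit₀ : IsUnit (LinearMap.toMatrix' (dirOp (lapOp η⁻¹ (fun μ => liftEquiv (τ μ) ι) W) (fun p : X × ι => χX p.1))))
    (hN : HasMaj (BlockNorm.ofBlocks g (liftBlk blk ι)) (BlockNorm.ofBlocks g (liftBlk blk ι)) (cubeRes (lapOp η⁻¹ (fun μ => liftEquiv (τ μ) ι) W) (fun p : X × ι => χX p.1))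
      (fun y y' => β * Real.exp (-(δ * g.dist y y'))))
    (hDN : ∀ μ, HasMaj (BlockNorm.ofBlocks g (liftBlk blk ι)) (BlockNorm.ofBlocks g (liftBlk blk ι))
      (fgrad η⁻¹ (liftEquiv (τ μ) ι) ∘ₗ cubeRes (lapOp η⁻¹ (fun μ => liftEquiv (τ μ) ι) W) (fun p : X × ι => χX p.1)) (fun y y' => β * Real.exp (-(δ * g.dist y y'))))
    (hDNb : ∀ μ, HasMaj (BlockNorm.ofBlocks g (liftBlk blk ι)) (BlockNorm.ofBlocks g (liftBlk blk ι))
      (bgrad η⁻¹ (liftEquiv (τ μ) ι) ∘ₗ cubeRes (lapOp η⁻¹ (fun μ => liftEquiv (τ μ) ι) W) (fun p : X × ι => χX p.1)) (fun y y' => β * Real.exp (-(δ * g.dist y y'))))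
    (hNd : HasMaj (BlockNorm.ofBlocks g (liftBlk blk ι)) (BlockNorm.ofBlocks g (liftBlk blk ι))
      (cubeRes (lapOp η⁻¹ (fun μ => liftEquiv (τ μ) ι) W) (fun p : X × ι => χX p.1) ∘ₗ mulOp (fun p : X × ι => ψ p.1)) (fun y y' => βd * Real.exp (-(δ * g.dist y y'))))
    (hDNd : ∀ μ, HasMaj (BlockNorm.ofBlocks g (liftBlk blk ι)) (BlockNorm.ofBlocks g (liftBlk blk ι))
      ((fgrad η⁻¹ (liftEquiv (τ μ) ι) ∘ₗ cubeRes (lapOp η⁻¹ (fun μ => liftEquiv (τ μ) ι) W) (fun p : X × ι => χX p.1)) ∘ₗ mulOp (fun p : X × ι => ψ p.1))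
      (fun y y' => βd * Real.exp (-(δ * g.dist y y'))))
    (hDNbd : ∀ μ, HasMaj (BlockNorm.ofBlocks g (liftBlk blk ι)) (BlockNorm.ofBlocks g (liftBlk blk ι))
      ((bgrad η⁻¹ (liftEquiv (τ μ) ι) ∘ₗ cubeRes (lapOp η⁻¹ (fun μ => liftEquiv (τ μ) ι) W) (fun p : X × ι => χX p.1)) ∘ₗ mulOp (fun p : X × ι => ψ p.1))
      (fun y y' => βd * Real.exp (-(δ * g.dist y y'))))
    (hq : (β * ((rC + rA) * (1 + Fintype.card (J ⊕ J))) + βd * (Fintype.card J * (2 * (cχ * rA)) * (1 + Fintype.card (J ⊕ J)))) * cr < 1) :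
    HasMaj (BlockNorm.ofBlocks g (liftBlk blk ι)) (BlockNorm.ofBlocks g (liftBlk blk ι)) (fgrad η⁻¹ (liftEquiv (τ μ) ι) ∘ₗ cubeInv (covLapM τ η U + W) (fun p : X × ι => χX p.1))
      (fun y y' => ind S y * ind S y' * ((1 + cχ) *
        (β * (1 - (β * ((rC + rA) * (1 + Fintype.card (J ⊕ J))) + βd * (Fintype.card J * (2 * (cχ * rA)) * (1 + Fintype.card (J ⊕ J)))) * cr)⁻¹) * Real.exp (-(ρ * g.dist y y')))) := by
  obtain ⟨hunit, hX⟩ := hasMaj_bgPairM_cmpr_bdry τ η⁻¹ χX (tCoefC η U) (tCoefA η U) blk (lapOp η⁻¹ (fun μ => liftEquiv (τ μ) ι) W) ψ htri hd hrow hσ hρ hρδ hβ hβd hrC hrA hcχ hχ hdχ hdχb hψ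
    hC hA hN hDN hDNb hNd hDNd hDNbd hq
  rw [covLapM_add_eq_lapOp_sub]
  exact hasMaj_fgrad_comp_cubeInv_of_pair blk τ η⁻¹ χX (tCoefC η U) (tCoefA η U) _ (mul_nonneg hβ (inv_nonneg.2 (by linarith))) hcχ hχ μ (hdχ μ) hS hSτ hunit₀ hunit hX

/-- ★★ **ENTRY 1 (backward) OF `cubeInv (Δ_U + W) χ`, PRINT-COMPATIBLE SMALLNESS** (FILE 55's `hDb`): `∇⁻_μ∘cubeInv (Δ_U + W) χ ≤ 1_S1_S·(1 + c_χ)β(1 − qc_r)⁻¹e^{−ρd}`.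
[cite: Balaban1984PropagatorsII, (2.133) p.247 (shape); Balaban1985BackgroundPropagators, p.399, (3.50)–(3.53) p.400] -/
theorem hasMaj_bgrad_comp_cubeInv_covLapM_add_bdry (htri : Triangle254 g) (hd : ∀ a b : g.Site, 0 ≤ g.dist a b) (hrow : RowSum g σ cr) (hσ : 0 ≤ σ) {ρ δ β βd rC rA cχ : ℝ}
    (hρ : 0 ≤ ρ) (hρδ : ρ + σ ≤ δ) (hβ : 0 ≤ β) (hβd : 0 ≤ βd) (hrC : 0 ≤ rC) (hrA : 0 ≤ rA) (hcχ : 0 ≤ cχ) {S : Set g.Site} (hχ : ∀ x, |χX x| ≤ 1)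
    (hdχ : ∀ μ x, |fgrad η⁻¹ (τ μ) χX x| ≤ cχ) (hdχb : ∀ μ x, |bgrad η⁻¹ (τ μ) χX x| ≤ cχ) (hψ : ∀ μ x, ψ x ≠ 1 → fgrad η⁻¹ (τ μ) χX x = 0 ∧ bgrad η⁻¹ (τ μ) χX x = 0)
    (hS : ∀ x, χX x ≠ 0 → blk x ∈ S) (μ : J) (hSτ : ∀ x, χX ((τ μ).symm x) ≠ 0 → blk x ∈ S) (hC : ∀ x i, ∑ k, |tCoefC η U x i k| ≤ rC)
    (hA : ∀ j x i, ∑ k, |tCoefA η U j x i k| ≤ rA)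
    (hunit₀ : IsUnit (LinearMap.toMatrix' (dirOp (lapOp η⁻¹ (fun μ => liftEquiv (τ μ) ι) W) (fun p : X × ι => χX p.1))))
    (hN : HasMaj (BlockNorm.ofBlocks g (liftBlk blk ι)) (BlockNorm.ofBlocks g (liftBlk blk ι)) (cubeRes (lapOp η⁻¹ (fun μ => liftEquiv (τ μ) ι) W) (fun p : X × ι => χX p.1))
      (fun y y' => β * Real.exp (-(δ * g.dist y y'))))
    (hDN : ∀ μ, HasMaj (BlockNorm.ofBlocks g (liftBlk blk ι)) (BlockNorm.ofBlocks g (liftBlk blk ι))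
      (fgrad η⁻¹ (liftEquiv (τ μ) ι) ∘ₗ cubeRes (lapOp η⁻¹ (fun μ => liftEquiv (τ μ) ι) W) (fun p : X × ι => χX p.1)) (fun y y' => β * Real.exp (-(δ * g.dist y y'))))
    (hDNb : ∀ μ, HasMaj (BlockNorm.ofBlocks g (liftBlk blk ι)) (BlockNorm.ofBlocks g (liftBlk blk ι))
      (bgrad η⁻¹ (liftEquiv (τ μ) ι) ∘ₗ cubeRes (lapOp η⁻¹ (fun μ => liftEquiv (τ μ) ι) W) (fun p : X × ι => χX p.1)) (fun y y' => β * Real.exp (-(δ * g.dist y y'))))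
    (hNd : HasMaj (BlockNorm.ofBlocks g (liftBlk blk ι)) (BlockNorm.ofBlocks g (liftBlk blk ι))
      (cubeRes (lapOp η⁻¹ (fun μ => liftEquiv (τ μ) ι) W) (fun p : X × ι => χX p.1) ∘ₗ mulOp (fun p : X × ι => ψ p.1)) (fun y y' => βd * Real.exp (-(δ * g.dist y y'))))
    (hDNd : ∀ μ, HasMaj (BlockNorm.ofBlocks g (liftBlk blk ι)) (BlockNorm.ofBlocks g (liftBlk blk ι))
      ((fgrad η⁻¹ (liftEquiv (τ μ) ι) ∘ₗ cubeRes (lapOp η⁻¹ (fun μ => liftEquiv (τ μ) ι) W) (fun p : X × ι => χX p.1)) ∘ₗ mulOp (fun p : X × ι => ψ p.1))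
      (fun y y' => βd * Real.exp (-(δ * g.dist y y'))))
    (hDNbd : ∀ μ, HasMaj (BlockNorm.ofBlocks g (liftBlk blk ι)) (BlockNorm.ofBlocks g (liftBlk blk ι))
      ((bgrad η⁻¹ (liftEquiv (τ μ) ι) ∘ₗ cubeRes (lapOp η⁻¹ (fun μ => liftEquiv (τ μ) ι) W) (fun p : X × ι => χX p.1)) ∘ₗ mulOp (fun p : X × ι => ψ p.1))
      (fun y y' => βd * Real.exp (-(δ * g.dist y y'))))
    (hq : (β * ((rC + rA) * (1 + Fintype.card (J ⊕ J))) + βd * (Fintype.card J * (2 * (cχ * rA)) * (1 + Fintype.card (J ⊕ J)))) * cr < 1) :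
    HasMaj (BlockNorm.ofBlocks g (liftBlk blk ι)) (BlockNorm.ofBlocks g (liftBlk blk ι)) (bgrad η⁻¹ (liftEquiv (τ μ) ι) ∘ₗ cubeInv (covLapM τ η U + W) (fun p : X × ι => χX p.1))
      (fun y y' => ind S y * ind S y' * ((1 + cχ) *
        (β * (1 - (β * ((rC + rA) * (1 + Fintype.card (J ⊕ J))) + βd * (Fintype.card J * (2 * (cχ * rA)) * (1 + Fintype.card (J ⊕ J)))) * cr)⁻¹) * Real.exp (-(ρ * g.dist y y')))) := by
  obtain ⟨hunit, hX⟩ := hasMaj_bgPairM_cmpr_bdry τ η⁻¹ χX (tCoefC η U) (tCoefA η U) blk (lapOp η⁻¹ (fun μ => liftEquiv (τ μ) ι) W) ψ htri hd hrow hσ hρ hρδ hβ hβd hrC hrA hcχ hχ hdχ hdχb hψ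
    hC hA hN hDN hDNb hNd hDNd hDNbd hq
  rw [covLapM_add_eq_lapOp_sub]
  exact hasMaj_bgrad_comp_cubeInv_of_pair blk τ η⁻¹ χX (tCoefC η U) (tCoefA η U) _ (mul_nonneg hβ (inv_nonneg.2 (by linarith))) hcχ hχ μ (hdχb μ) hS hSτ hunit₀ hunit hX

end CovariantBdry

end Summit.QuantumFields.YangMills.BalabanUVNodes.N15.CurvedSpecies

end
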